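import Summits.BirchSwinnertonDyer.Rank1Residual.X11b.Three.KolyvaginLineCertificate
import Literature.NumberTheory.EllipticCurves.HeegnerPointsKolyvaginStructure
import Literature.NumberTheory.EllipticCurves.HeegnerPointsKolyvaginPrimaryClassesProofs
import Literature.NumberTheory.EllipticCurves.SkinnerZhang2014.KolyvaginNonvanishing
import HarnessLib

/-!
# X11b / STEP L on the KOLYVAGIN LINE: Kolyvagin's conjecture (W. Zhang 2014, Thm. 1.1, mod-`p`
# form) ⇒ a level-`1` certificate ⇒ STEP L `IndexLowerBoundAt W p K P` — STEP-0 of cell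
# `bsd-stepL`, seat `bsd-stepL-koly` (strategy = Kolyvagin structure theorem)

HONEST FRAMING (cell `bsd-stepL`, `run/shared/lean/pub/bsd-stepL/README.md`, FULL-BSD RANK ≤ 1
programme D-0033 tranche 1a, rows B9/B10/A9): STEP-0 = *reproduce the nearest PRINTED
construction in the tree's currency on a covered pair* before any new statement. The nearest
printed construction for this seat is W. Zhang's proof of Kolyvagin's conjecture (Camb. J. Math. 2
(2014), Thm. 1.1 — `c_1(n) ≠ 0` for some `n ∈ Λ`, i.e. `M_∞ = 0`) followed by Kolyvagin's
structure theorem (McCallum 1991, Cor. 5.6: `ord_p #Ш(E/K) = 2(M₀ − M_∞)`), which is Zhang's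
Thm. 10.2 (the `p`-part of BSD for `E/K` in rank one). THIS FILE: theorems only apart from ONE
cited named fact written inline for gate relocation (Zhang's Thm. 1.1 at `N⁻ = 1`, in the
currency of the tree's sibling fact `BurungaleEtAl2026_exists_kolyvaginClass_ne_zero`); no
`sorry`; nothing about `p = 3` is asserted; nothing booked; O2 / N8 unchanged.

## What is here

* `Koly.kolyvaginClass_eq_zero_of_pDiv` / `Koly.not_pDiv_of_kolyvaginClass_ne_zero` — the bridge
  between the two currencies the tree uses for Kolyvagin's classes: McCallum's cocycle class
  `c_M(n) = d.kolyvaginClass _ M ∈ H¹(K, E[p^M])` (`HeegnerPointsOfConductor`) and the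
  divisibility certificate `PDiv d p M` (`P_n ∈ p^M E(K[n])`, `KolyvaginLine`): a `p^M`-divisible
  `P_n` has vanishing class (Gross 1991, Prop. 4.7 (1) "if"; McCallum 1991, Cor. 4.5).
* `Koly.CertificateAt Dt β ι p M` — "a level-`(M+1)` certificate exists": some `n ∈ S_r(M+1)`
  carries a datum with `P_n ∉ p^{M+1} E(K[n])`; equivalently (`minf_le_of_certificateAt`)
  McCallum's `M_∞ ≤ M`. `CertificateAt … p 0` is Kolyvagin's conjecture in W. Zhang's (strong,
  mod-`p`) form; `CertificateAt … p t` with `t = ord_p ∏ c_ℓ(E/ℚ)` is the K0⋆ form of STEP L on the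
  atom (T2′) (`cells/x11b3/LINE-K.md`, K0⋆: STEP L ⟺ `M_∞ ≤ t`).
* `Koly.certificateAt_zero_of_kolyvaginClass_one_ne_zero` — Zhang's conclusion `c_1(n) ≠ 0`,
  `n ∈ Λ`, IS a level-`1` certificate.
* `Koly.indexLowerBoundAt_of_certificateAt_of_mccallum`, and the STEP-0 theorems
  `Koly.indexLowerBoundAt_of_kolyvaginClass_one_ne_zero_of_mccallum` (any odd `p`, any datum: a
  non-zero `c_1(n)` gives STEP L with NO Tamagawa hypothesis, since `0 ≤ t`) and
  `Koly.exists_indexLowerBoundAt_of_zhang2014_of_mccallum` (at a pair covered by print — `p ≥ 5`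
  good ordinary, `ρ̄_{E,p}` onto, Hypothesis ♠ at `N⁻ = 1` — the two cited facts give STEP L for
  the Heegner point of the paper's normalisation). Both are CONDITIONAL on the named facts taken
  as hypotheses (`hMc`, `hZ`); the gate records `proof.conditional`.

## Sources

* W. Zhang, *Selmer groups and the indivisibility of Heegner points*, Camb. J. Math. 2 (2014)
  191–253: Thm. 1.1 (p. 195, held text `paper:doi-10-4310-cjm-2014-v2-n2-a2` p0005 L12–L25),
  Hypothesis ♠ (pp. 194–195, p0004 L38 – p0005 L8), Kolyvagin primes and `c_M(n)` (p. 194,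
  p0004 L23–L31), Remark 5 / Thm. 10.2 (p. 199: "in the analytic rank one case, the `p`-part of the
  B-SD formula for `E/K` is equivalent to a certain `p`-indivisibility property of `κ^∞` … (i.e.
  `M_∞ = 0`)"). [WZhang2014]
* W. G. McCallum, *Kolyvagin's work on Shafarevich–Tate groups*, LMS LN 153 (1991): Cor. 4.5,
  Lemma 5.1, Cor. 5.6. [McCallumLMS1991]
* B. H. Gross, *Kolyvagin's work on modular elliptic curves*, LMS LN 153 (1991): Prop. 4.7 (1).
  [GrossLMS1991]
* Team files: `cells/x11b3/LINE-K.md` (K0⋆, K5), `X11b/Three/KolyvaginLine.lean`,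
  `X11b/Three/KolyvaginLineCertificate.lean`.
-/

noncomputable section

open scoped Classical

/-! ### The cited fact (inline; the gate relocates it next to its sibling) -/

namespace Literature.NumberTheory.EllipticCurves

open WeierstrassCurve Literature.NumberTheory.EllipticCurves.ModularForms

/-- **W. Zhang 2014, Theorem 1.1 — Kolyvagin's conjecture in its mod-`p` form — in the classical
case `N⁻ = 1`** (Camb. J. Math. 2 (2014), p. 195, verbatim): "Let `E/ℚ` be an elliptic curve of
conductor `N`, `p` a prime and `K` an imaginary quadratic field, such that • `N⁻` is square-free
with even number of prime factors. • The residue representation `ρ̄_{E,p}` is surjective.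
• Hypothesis ♠ holds for `(E, p, K)`. • The prime `p ≥ 5` is ordinary, `p ∤ D_K N` and
`(D_K, N) = 1`. Then we have `c_1(n) ≠ 0` for some `n ∈ Λ`, and hence `κ^∞ ≠ {0}`." — with
(p. 194) "`K = ℚ[√−D]` … of discriminant `D_K = −D < 0` with `(D, N) = 1`. Write `N = N⁺N⁻` where
the prime factors of `N⁺` (`N⁻`, resp.) are all split (inert, resp.) in `K`"; "We call a prime
`ℓ` a Kolyvagin prime if `ℓ` is prime to `NDp`, inert in `K` and the Kolyvagin index
`M(ℓ) := min{v_p(ℓ+1), v_p(a_ℓ)}` is strictly positive. Let `Λ` be the set of square-free product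
of distinct Kolyvagin primes … To each `y(n)` and `M ≤ M(n)`, Kolyvagin associated a cohomology
class `c_M(n) ∈ H¹(K, E[p^M])`"; (pp. 194–195) "Let `Ram(ρ̄_{E,p})` be the set of primes `ℓ ∥ N`
such that `ρ̄_{E,p}` is ramified at `ℓ` … Hypothesis ♠ for `(E, p, K)`: (1) `Ram(ρ̄_{E,p})`
contains all primes `ℓ` such that `ℓ ∥ N⁺` and all primes `ℓ | N⁻` such that `ℓ ≡ ±1 mod p`.
(2) If `N` is not square-free, then `#Ram(ρ̄_{E,p}) ≥ 1`, and either `Ram(ρ̄_{E,p})` contains a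
prime `ℓ ∥ N⁻` or there are at least two primes factors `ℓ ∥ N⁺`."
TRANSCRIPTION, SPECIAL CASE `N⁻ = 1` (every prime factor of `N` splits in `K`: the tree's
`SatisfiesHeegnerHypothesis N K`, which also gives `(D_K, N) = 1`; the Kolyvagin data of the tree
are those of the modular curve `X₀(N)`, Gross 1991 §§3–4, which is the paper's `X_{N⁺,N⁻}` at
`N⁻ = 1`), in the currency of the sibling `BurungaleEtAl2026_exists_kolyvaginClass_ne_zero`
VERBATIM where the two overlap: `W` a globally minimal model (`N = W.conductorNorm ℤ`, `Δ_min`,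
`a_ℓ = W.frobeniusTrace ℓ`); "`p ≥ 5` ordinary, `p ∤ N`" = `5 ≤ p`, good reduction at `p`,
`p ∤ a_p`; `ρ̄_{E,p}` onto = `W.HasSurjectiveModNGaloisRep p`; "`ℓ ∥ N`" = multiplicative
reduction at `ℓ`, and for such `ℓ` "`ρ̄_{E,p}` ramified at `ℓ`" ⟺ `p ∤ v_ℓ(Δ_min)` (Tate curve; the
convention of the tree's Zhang facts `WZhang2014_padicValRat_bsd_rank_one_ordinary`,
`WZhang2014.thm14i_…`), so ♠(1) at `N⁻ = 1` reads: every multiplicative `ℓ` has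
`p ∤ v_ℓ(Δ_min)`; ♠(2) at `N⁻ = 1`: if `W` is not semistable then there are two distinct
multiplicative primes (then `#Ram ≥ 1` by (1)); `p ∤ D_K`; CONCLUSION: there are a modular
parametrisation datum `Dt` of level `N` (the paper's fixed parametrisation, §3.2), an orientation
`β`, an embedding `ι : K → ℂ`, a square-free product `n` of Kolyvagin primes
(`KolyvaginDescent.KolSupp (Zhang2014.IsKolyvaginPrime N W K p) n`, so `1 ≤ M(n)`) and a
Kolyvagin–Heegner datum `d` of conductor `n` (the point `y(n) ∈ E(K[n])` is CM theory, data here as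
in the sibling) whose class `c_1(n) = d.kolyvaginClass _ 1 ∈ H¹(K, E[p])` is NON-ZERO. Weaker than
print (existential over the normalisation; `N⁻ = 1` only); never stronger.
`-- TODO(general form): N⁻ square-free with an even number of prime factors (Shimura curves
X_{N⁺,N⁻}), which the tree has no Kolyvagin data for.`
Size XL (level raising, Jochnowitz congruences / the two reciprocity laws of Bertolini–Darmon,
Skinner–Urban + Kato); refereed, in print; no `_holds`.
[cite: WZhang2014, Thm. 1.1 (p. 195); Hypothesis ♠ (pp. 194–195); Notations (xii) (p. 202); Thm. 9.3]
[file NumberTheory/EllipticCurves/HeegnerPointsKolyvaginStructure] -/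
def WZhang2014_exists_kolyvaginClass_one_ne_zero : Prop :=
  ∀ (W : WeierstrassCurve ℚ) [W.IsElliptic] [W.IsGloballyMinimal] (p : ℕ) [hp : Fact p.Prime],
    5 ≤ p → W.HasGoodReductionAtPrime p → ¬ (p : ℤ) ∣ W.frobeniusTrace p →
    W.HasSurjectiveModNGaloisRep p →
    (∀ (ℓ : ℕ) [Fact ℓ.Prime], W.HasMultiplicativeReductionAtPrime ℓ →
      ¬ p ∣ padicValInt ℓ W.minimalDiscriminantInt) →
    (¬ W.IsSemistable ℤ → ∃ (ℓ₁ ℓ₂ : ℕ) (_ : Fact ℓ₁.Prime) (_ : Fact ℓ₂.Prime), ℓ₁ ≠ ℓ₂ ∧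
      W.HasMultiplicativeReductionAtPrime ℓ₁ ∧ W.HasMultiplicativeReductionAtPrime ℓ₂) →
    ∀ (K : Type) [Field K] [NumberField K], IsImaginaryQuadratic K →
      ∀ [NeZero (W.conductorNorm ℤ)], SatisfiesHeegnerHypothesis (W.conductorNorm ℤ) K →
      ¬ ((p : ℤ) ∣ NumberField.discr K) →
      ∃ (Dt : ModularParametrizationData W (W.conductorNorm ℤ)) (β : ℤ) (ι : K →+* ℂ) (n : ℕ)
        (d : KolyvaginHeegnerData Dt β ι n),
        KolyvaginDescent.KolSupp (Zhang2014.IsKolyvaginPrime (W.conductorNorm ℤ) W K p) n ∧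
          (1 : ℕ∞) ≤ Zhang2014.levelIndex W p n ∧ d.kolyvaginClass hp.out 1 ≠ 0

end Literature.NumberTheory.EllipticCurves

namespace Summit.BirchSwinnertonDyer.Rank1Residual.X11b.Three.Koly

open WeierstrassCurve Literature.NumberTheory.EllipticCurves
  Literature.NumberTheory.EllipticCurves.ModularForms

universe u

/-! ### The bridge: a `p^M`-divisible derived point has vanishing class -/

section Bridge

variable {N : ℕ} [NeZero N] {W : WeierstrassCurve ℚ} {K : Type u} [Field K] [NumberField K]
  {Dt : ModularParametrizationData W N} {β : ℤ} {ι : K →+* ℂ} {n : ℕ}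

/-- **`P_n ∈ p^M E(K[n]) ⇒ c_M(n) = 0`** (Gross 1991, Prop. 4.7 (1), "if"; McCallum 1991,
Cor. 4.5: *"`c_M(n) = 0` if and only if `P_n ∈ p^M E(K_n)`"*): on the admissible branch of
`kolyvaginClass` a `p^M`-th root `Q ∈ E(K[n])` of `P_n` maps to a root of the image of `P_n`
inside `A = E(K[n]) ⊆ E(K̄)`, so McCallum's class vanishes (`KolyvaginCocycle.cls_eq_zero_of_mem`);
off it the class is `0` by definition. [cite: GrossLMS1991, Prop. 4.7 (1)] [cite: McCallumLMS1991, Cor. 4.5] -/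
theorem kolyvaginClass_eq_zero_of_pDiv (d : KolyvaginHeegnerData Dt β ι n) {p : ℕ} (hp : p.Prime)
    (M : ℕ) (h : PDiv d p M) : d.kolyvaginClass hp M = 0 := by
  obtain ⟨Q, hQ⟩ := h
  have hB : ((p ^ M : ℕ) : ℤ) • d.toGeomPoints Q = d.toGeomPoints d.derivedPoint := by
    rw [← map_zsmul, hQ]
  rw [KolyvaginHeegnerData.kolyvaginClass]
  split_ifs with hadm
  · rw [kolyvaginClass_eq_cls hadm.1 hadm.2 hB]
    exact KolyvaginCocycle.cls_eq_zero_of_mem hadm.1 _ hadm.2 hB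
      ⟨d.toGeomPoints Q, AddMonoidHom.mem_range.mpr ⟨Q, rfl⟩, hB⟩
  · rfl

/-- **`c_M(n) ≠ 0 ⇒ P_n ∉ p^M E(K[n])`**: a non-zero Kolyvagin class is a level-`M` certificate
(contrapositive of `kolyvaginClass_eq_zero_of_pDiv`). [cite: McCallumLMS1991, Cor. 4.5] -/
theorem not_pDiv_of_kolyvaginClass_ne_zero (d : KolyvaginHeegnerData Dt β ι n) {p : ℕ}
    {hp : p.Prime} {M : ℕ} (h : d.kolyvaginClass hp M ≠ 0) : ¬ PDiv d p M :=
  fun hdiv ↦ h (kolyvaginClass_eq_zero_of_pDiv d hp M hdiv)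

end Bridge

/-! ### Certificates: `M_∞ ≤ M` in finite form -/

section Certificates

variable {N : ℕ} [NeZero N] {W : WeierstrassCurve ℚ} [W.IsGloballyMinimal] {K : Type u} [Field K]
  [NumberField K] (Dt : ModularParametrizationData W N) (β : ℤ) (ι : K →+* ℂ)

/-- **A level-`(M+1)` certificate exists** for the Kolyvagin system of `(Dt, β, ι)` at `p`: some
square-free `n` with `r` prime factors, all Kolyvagin primes of index `≥ M + 1` (`n ∈ S_r(M+1)`,
`MemS`), carries a Kolyvagin–Heegner datum `d` with `P_n ∉ p^{M+1} E(K[n])`. By McCallum's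
definitions this is `M_r ≤ M` for some `r`, i.e. `M_∞ ≤ M` (`minf_le_of_certificateAt`). At `M = 0`
it is Kolyvagin's conjecture in W. Zhang's mod-`p` form (`c_1(n) ≠ 0` for some `n ∈ Λ`,
`certificateAt_zero_of_kolyvaginClass_one_ne_zero`); at `M = t := ord_p ∏_ℓ c_ℓ(E/ℚ)` it is the
K0⋆ form of STEP L (`indexLowerBoundAt_of_certificateAt_of_mccallum`). A statement shape; nothing
is asserted. [cite: McCallumLMS1991, §5 (p. 303), definition of M_r; Cor. 5.6 (p. 310)]
[cite: WZhang2014, Thm. 1.1 (p. 195)] -/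
def CertificateAt (p M : ℕ) : Prop :=
  ∃ (n r : ℕ) (d : KolyvaginHeegnerData Dt β ι n), MemS N W K p r (M + 1) n ∧ ¬ PDiv d p (M + 1)

variable {Dt β ι}

/-- **A certificate bounds `M_∞`**: `CertificateAt … p M → M_∞ ≤ M` (McCallum's definitions of
`M_r`, `M_∞`; `KolyvaginLine.minf_le_of_certificate`). [cite: McCallumLMS1991, §5 (p. 303) and Cor. 5.6 (p. 310)] -/
theorem minf_le_of_certificateAt {p M : ℕ} (h : CertificateAt Dt β ι p M) : Minf Dt β ι p ≤ M := by
  obtain ⟨n, r, d, hn, hcert⟩ := h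
  exact minf_le_of_certificate d p hn hcert

/-- **Zhang's conclusion is a level-`1` certificate**: if `n` is a square-free product of Kolyvagin
primes (`n ∈ Λ`, so `n ∈ S_{ω(n)}(1)`) and `c_1(n) ≠ 0` for a datum `d` of conductor `n`, then
`P_n ∉ p E(K[n])` (`not_pDiv_of_kolyvaginClass_ne_zero`) and `CertificateAt … p 0` holds — in
McCallum's words `M_∞ = 0`. [cite: WZhang2014, Thm. 1.1 (p. 195) and Remark 5 (p. 199, "M_∞ = 0")]
[cite: McCallumLMS1991, Cor. 4.5] -/
theorem certificateAt_zero_of_kolyvaginClass_one_ne_zero {p : ℕ} [hp : Fact p.Prime] {n : ℕ}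
    (d : KolyvaginHeegnerData Dt β ι n)
    (hn : KolyvaginDescent.KolSupp (Zhang2014.IsKolyvaginPrime N W K p) n)
    (hne : d.kolyvaginClass hp.out 1 ≠ 0) : CertificateAt Dt β ι p 0 := by
  refine ⟨n, n.primeFactors.card, d, ⟨hn.1, rfl, fun ℓ hℓ ↦ ⟨hn.2 ℓ hℓ, ?_⟩⟩, ?_⟩
  · exact (hn.2 ℓ hℓ).2.2.2.2.2
  · simpa using not_pDiv_of_kolyvaginClass_ne_zero d hne

end Certificates

/-! ### STEP L from a certificate / from Zhang's conclusion (conditional on McCallum's Cor. 5.6) -/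

section Consumer

variable (W : WeierstrassCurve ℚ) [W.IsElliptic] [W.IsGloballyMinimal] [NeZero (W.conductorNorm ℤ)]
  (K : Type) [Field K] [NumberField K]

/-- **STEP L from a level-`(M+1)` certificate with `M ≤ t` (K0⋆), via the cited Kolyvagin–McCallum
fact.** For `W/ℚ` globally minimal non-CM, `K` imaginary quadratic Heegner for `N_E` with
`d_K ∉ {−3, −4}`, `p` odd with `ρ̄_{E,p^m}` onto for all `m` (the fact's binder), the conductor-`1`
datum `d₁` and `P ∈ E(K)` under `P_1 = y_K`, of infinite order, `E(K)` of rank one without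
`p`-torsion, `Ш(E/K)` finite, `p^{M₀} ∥ P` in `E(K)`: a certificate `CertificateAt Dt β ι p M` with
`M ≤ t = ord_p ∏ c_ℓ(E/ℚ)` gives `X11b.IndexLowerBoundAt W p K P`
(`2·ord_p[E(K):ℤP] ≤ ord_p #Ш(E/K) + 2t`). This is `indexLowerBoundAt_of_certificate_of_mccallum`
with the certificate packaged. CONDITIONAL on `McCallum1991_pow_dvd_card_sha_primary_of_certificate`
(`hMc`). [cite: McCallumLMS1991, §5 Cor. 5.6 (p. 310) and Lemma 5.1 (p. 303)] -/
theorem indexLowerBoundAt_of_certificateAt_of_mccallum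
    (hMc : McCallum1991_pow_dvd_card_sha_primary_of_certificate)
    (hCM : ¬ W.HasCM) (hK : IsImaginaryQuadratic K)
    (h3 : NumberField.discr K ≠ -3) (h4 : NumberField.discr K ≠ -4)
    (hH : SatisfiesHeegnerHypothesis (W.conductorNorm ℤ) K)
    (p : ℕ) [Fact p.Prime] (hp : p ≠ 2) (hsurj : ∀ m : ℕ, W.HasSurjectiveModNGaloisRep (p ^ m : ℕ))
    (Dt : ModularParametrizationData W (W.conductorNorm ℤ)) (β : ℤ) (ι : K →+* ℂ)
    (d₁ : KolyvaginHeegnerData Dt β ι 1) (P : (W.baseChange K).toAffine.Point)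
    (hP : d₁.toGeomPoints d₁.derivedPoint = toGeomPoints (W.baseChange K) P)
    (hPinf : ¬ IsOfFinAddOrder P)
    (hrank : (W.baseChange K).mordellWeilRank = 1)
    (hiv : ∀ x : (W.baseChange K).toAffine.Point, p • x = 0 → x = 0)
    [Finite (W.baseChange K).sha] {M₀ : ℕ}
    (hdiv : ∃ Q : (W.baseChange K).toAffine.Point, ((p ^ M₀ : ℕ) : ℤ) • Q = P)
    (hndiv : ¬ ∃ Q : (W.baseChange K).toAffine.Point, ((p ^ (M₀ + 1) : ℕ) : ℤ) • Q = P)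
    {M : ℕ} (hcert : CertificateAt Dt β ι p M) (hMt : M ≤ padicValNat p W.tamagawaProduct) :
    IndexLowerBoundAt W p K P := by
  obtain ⟨n, r, d, hn, hc⟩ := hcert
  exact indexLowerBoundAt_of_certificate_of_mccallum hMc W hCM K hK h3 h4 hH p hp hsurj Dt β ι d₁ P
    hP hPinf hrank hiv hdiv hndiv d hn.1 hn.2.2 hc hMt

/-- **STEP-0, pointwise form: a NON-ZERO `c_1(n)` (`n ∈ Λ`) gives STEP L — for every odd `p` and
with NO Tamagawa hypothesis** (the certificate has level `1`, i.e. `M = 0 ≤ t` always). This is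
W. Zhang's Remark 5 / Thm. 10.2 read in the tree's STEP-L currency: `M_∞ = 0` and McCallum's
Cor. 5.6 give `ord_p #Ш(E/K) = 2·ord_p[E(K):ℤy_K]`, in particular
`2·ord_p[E(K):ℤy_K] ≤ ord_p #Ш(E/K) + 2t`. CONDITIONAL on `hMc`. The hypotheses on `(E, p, K)` are
the McCallum fact's (non-CM, `d_K ∉ {−3,−4}`, Heegner, `p` odd, tower surjectivity), NOT Zhang's:
the theorem applies verbatim at `p = 3 ∥ N` once a non-zero `c_1(n)` is supplied there (the open
content of this seat; nothing of the kind is asserted here).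
[cite: WZhang2014, Remark 5 and Thm. 10.2 (p. 199)] [cite: McCallumLMS1991, §5 Cor. 5.6 (p. 310)] -/
theorem indexLowerBoundAt_of_kolyvaginClass_one_ne_zero_of_mccallum
    (hMc : McCallum1991_pow_dvd_card_sha_primary_of_certificate)
    (hCM : ¬ W.HasCM) (hK : IsImaginaryQuadratic K)
    (h3 : NumberField.discr K ≠ -3) (h4 : NumberField.discr K ≠ -4)
    (hH : SatisfiesHeegnerHypothesis (W.conductorNorm ℤ) K)
    (p : ℕ) [hp : Fact p.Prime] (hp2 : p ≠ 2)
    (hsurj : ∀ m : ℕ, W.HasSurjectiveModNGaloisRep (p ^ m : ℕ))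
    (Dt : ModularParametrizationData W (W.conductorNorm ℤ)) (β : ℤ) (ι : K →+* ℂ)
    (d₁ : KolyvaginHeegnerData Dt β ι 1) (P : (W.baseChange K).toAffine.Point)
    (hP : d₁.toGeomPoints d₁.derivedPoint = toGeomPoints (W.baseChange K) P)
    (hPinf : ¬ IsOfFinAddOrder P)
    (hrank : (W.baseChange K).mordellWeilRank = 1)
    (hiv : ∀ x : (W.baseChange K).toAffine.Point, p • x = 0 → x = 0)
    [Finite (W.baseChange K).sha] {M₀ : ℕ}
    (hdiv : ∃ Q : (W.baseChange K).toAffine.Point, ((p ^ M₀ : ℕ) : ℤ) • Q = P)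
    (hndiv : ¬ ∃ Q : (W.baseChange K).toAffine.Point, ((p ^ (M₀ + 1) : ℕ) : ℤ) • Q = P)
    {n : ℕ} (d : KolyvaginHeegnerData Dt β ι n)
    (hn : KolyvaginDescent.KolSupp (Zhang2014.IsKolyvaginPrime (W.conductorNorm ℤ) W K p) n)
    (hne : d.kolyvaginClass hp.out 1 ≠ 0) :
    IndexLowerBoundAt W p K P :=
  indexLowerBoundAt_of_certificateAt_of_mccallum W K hMc hCM hK h3 h4 hH p hp2 hsurj Dt β ι d₁ P hP
    hPinf hrank hiv hdiv hndiv (certificateAt_zero_of_kolyvaginClass_one_ne_zero d hn hne)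
    (Nat.zero_le _)

/-- **STEP-0 at a pair covered by print (W. Zhang 2014, Thm. 1.1 + McCallum 1991, Cor. 5.6 ⇒
STEP L).** Let `W/ℚ` be globally minimal, `p ≥ 5` a prime of good ORDINARY reduction with
`ρ̄_{E,p}` onto, Hypothesis ♠ at `N⁻ = 1` (every multiplicative `ℓ` has `p ∤ v_ℓ(Δ_min)`; if `N`
is not square-free there are two multiplicative primes), `K` imaginary quadratic with the Heegner
hypothesis for `N_E` and `p ∤ d_K` — the hypotheses of Zhang's Thm. 1.1 (`hZ`); and, for the
McCallum fact (`hMc`), `W` non-CM, `d_K ∉ {−3, −4}`, `ρ̄_{E,p^m}` onto for all `m`. THEN there is a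
normalisation `(Dt, β, ι)` of the Heegner–Kolyvagin data (the paper's) such that for every point
`P ∈ E(K)` which is the trace `y_K = P_1` of its conductor-`1` Heegner point, of infinite order,
with `E(K)` of rank one without `p`-torsion, `Ш(E/K)` finite and `p^{M₀} ∥ P`:
`X11b.IndexLowerBoundAt W p K P`. (At such a pair `t = ord_p ∏ c_ℓ = 0` by ♠(1) and `p ≥ 5`, and the
structure theorem gives the EQUALITY `ord_p #Ш(E/K) = 2 ord_p[E(K):ℤy_K]` — Zhang's Thm. 10.2; only
the STEP-L inequality is recorded, in the route's currency.) CONDITIONAL on the two named facts.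
[cite: WZhang2014, Thm. 1.1 (p. 195), Thm. 10.2 and Remark 5 (p. 199)]
[cite: McCallumLMS1991, §5 Cor. 5.6 (p. 310)] -/
theorem exists_indexLowerBoundAt_of_zhang2014_of_mccallum
    (hZ : WZhang2014_exists_kolyvaginClass_one_ne_zero)
    (hMc : McCallum1991_pow_dvd_card_sha_primary_of_certificate)
    (p : ℕ) [hp : Fact p.Prime] (hp5 : 5 ≤ p) (hgood : W.HasGoodReductionAtPrime p)
    (hord : ¬ (p : ℤ) ∣ W.frobeniusTrace p) (hρ : W.HasSurjectiveModNGaloisRep p)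
    (hram : ∀ (ℓ : ℕ) [Fact ℓ.Prime], W.HasMultiplicativeReductionAtPrime ℓ →
      ¬ p ∣ padicValInt ℓ W.minimalDiscriminantInt)
    (htwo : ¬ W.IsSemistable ℤ → ∃ (ℓ₁ ℓ₂ : ℕ) (_ : Fact ℓ₁.Prime) (_ : Fact ℓ₂.Prime), ℓ₁ ≠ ℓ₂ ∧
      W.HasMultiplicativeReductionAtPrime ℓ₁ ∧ W.HasMultiplicativeReductionAtPrime ℓ₂)
    (hK : IsImaginaryQuadratic K) (hH : SatisfiesHeegnerHypothesis (W.conductorNorm ℤ) K)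
    (hpd : ¬ ((p : ℤ) ∣ NumberField.discr K))
    (hCM : ¬ W.HasCM) (h3 : NumberField.discr K ≠ -3) (h4 : NumberField.discr K ≠ -4)
    (hsurj : ∀ m : ℕ, W.HasSurjectiveModNGaloisRep (p ^ m : ℕ))
    (hrank : (W.baseChange K).mordellWeilRank = 1)
    (hiv : ∀ x : (W.baseChange K).toAffine.Point, p • x = 0 → x = 0)
    [Finite (W.baseChange K).sha] :
    ∃ (Dt : ModularParametrizationData W (W.conductorNorm ℤ)) (β : ℤ) (ι : K →+* ℂ),
      ∀ (d₁ : KolyvaginHeegnerData Dt β ι 1) (P : (W.baseChange K).toAffine.Point),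
        d₁.toGeomPoints d₁.derivedPoint = toGeomPoints (W.baseChange K) P →
        ¬ IsOfFinAddOrder P →
        ∀ (M₀ : ℕ), (∃ Q : (W.baseChange K).toAffine.Point, ((p ^ M₀ : ℕ) : ℤ) • Q = P) →
          (¬ ∃ Q : (W.baseChange K).toAffine.Point, ((p ^ (M₀ + 1) : ℕ) : ℤ) • Q = P) →
          IndexLowerBoundAt W p K P := by
  obtain ⟨Dt, β, ι, n, d, hn, -, hne⟩ :=
    hZ W p hp5 hgood hord hρ (fun ℓ _ hm ↦ hram ℓ hm) htwo K hK hH hpd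
  have hp2 : p ≠ 2 := by omega
  exact ⟨Dt, β, ι, fun d₁ P hP hPinf M₀ hdiv hndiv ↦
    indexLowerBoundAt_of_kolyvaginClass_one_ne_zero_of_mccallum W K hMc hCM hK h3 h4 hH p hp2 hsurj
      Dt β ι d₁ P hP hPinf hrank hiv hdiv hndiv d hn hne⟩

/-- **N8 reading (row B9, p ≥ 5, p ∥ N): Skinner–Zhang 2014 Thm 1.3 (an OPEN CLAIM, preprint)
+ McCallum 1991 Cor. 5.6 ⇒ STEP L on the Skinner–Zhang locus.** For `W/ℚ` globally minimal with
`p ∥ N`, `p ≥ 5`, `ρ̄_{E,p}` irreducible and not finite at `p` (`p ∤ v_p(Δ_min)`; split case: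
`ord_p log_p q_E = 1`), Hypothesis ♠ at `N⁻ = 1` (every multiplicative `ℓ ≠ p` ramified mod `p`, and
one such `ℓ` exists), `K` imaginary quadratic Heegner for `N_E` (so `p` splits in `K`); and, for the
McCallum fact, `W` non-CM, `d_K ∉ {−3,−4}`, `ρ̄_{E,p^m}` onto for all `m`, `E(K)` of rank one
without `p`-torsion, `Ш(E/K)` finite: there is a normalisation `(Dt, β, ι)` such that
`X11b.IndexLowerBoundAt W p K P` holds for the Heegner point `P = y_K` (`p^{M₀} ∥ P`).
CONDITIONAL on the unrefereed claim `SkinnerZhang2014.thm1_3_exists_kolyvaginClass_one_ne_zero_OPEN`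
(`hSZ`, arXiv:1407.1099 Thm 1.3 — NOT a theorem of the tree) and on the McCallum fact (`hMc`). On
N8's TRUE-OPEN atoms the standing hypotheses of `hSZ` fail by construction of the atoms (memo
`run/shared/lean/pub/bsd-stepL/koly/MEMO-v1.md` §1a/§5); this records the kernel SHAPE of
"SZ14 ⇒ STEP L" for the cell's N8 column. [claim: SkinnerZhang2014, status: under-review]
[cite: McCallumLMS1991, §5 Cor. 5.6 (p. 310)] -/
theorem exists_indexLowerBoundAt_of_skinnerZhang2014_of_mccallum
    (hSZ : SkinnerZhang2014.thm1_3_exists_kolyvaginClass_one_ne_zero_OPEN)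
    (hMc : McCallum1991_pow_dvd_card_sha_primary_of_certificate)
    (p : ℕ) [hp : Fact p.Prime] (hp5 : 5 ≤ p) (hmult : W.HasMultiplicativeReductionAtPrime p)
    (hirr : W.HasIrreducibleModPGaloisRep p)
    (hfin : ¬ p ∣ padicValInt p W.minimalDiscriminantInt)
    (hL : W.HasSplitMultiplicativeReductionAtPrime p →
      ∀ D : TateParameterData W p, (padicLog p D.q).valuation = 1)
    (hram : ∀ (ℓ : ℕ) [Fact ℓ.Prime], ℓ ≠ p → W.HasMultiplicativeReductionAtPrime ℓ →
      ¬ p ∣ padicValInt ℓ W.minimalDiscriminantInt)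
    (hRam : ∃ (ℓ : ℕ) (_ : Fact ℓ.Prime), ℓ ≠ p ∧ W.HasMultiplicativeReductionAtPrime ℓ ∧
      ¬ p ∣ padicValInt ℓ W.minimalDiscriminantInt)
    (hK : IsImaginaryQuadratic K) (hH : SatisfiesHeegnerHypothesis (W.conductorNorm ℤ) K)
    (hCM : ¬ W.HasCM) (h3 : NumberField.discr K ≠ -3) (h4 : NumberField.discr K ≠ -4)
    (hsurj : ∀ m : ℕ, W.HasSurjectiveModNGaloisRep (p ^ m : ℕ))
    (hrank : (W.baseChange K).mordellWeilRank = 1)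
    (hiv : ∀ x : (W.baseChange K).toAffine.Point, p • x = 0 → x = 0)
    [Finite (W.baseChange K).sha] :
    ∃ (Dt : ModularParametrizationData W (W.conductorNorm ℤ)) (β : ℤ) (ι : K →+* ℂ),
      ∀ (d₁ : KolyvaginHeegnerData Dt β ι 1) (P : (W.baseChange K).toAffine.Point),
        d₁.toGeomPoints d₁.derivedPoint = toGeomPoints (W.baseChange K) P →
        ¬ IsOfFinAddOrder P →
        ∀ (M₀ : ℕ), (∃ Q : (W.baseChange K).toAffine.Point, ((p ^ M₀ : ℕ) : ℤ) • Q = P) →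
          (¬ ∃ Q : (W.baseChange K).toAffine.Point, ((p ^ (M₀ + 1) : ℕ) : ℤ) • Q = P) →
          IndexLowerBoundAt W p K P := by
  obtain ⟨Dt, β, ι, n, d, hn, -, hne⟩ :=
    hSZ W p hp5 hmult hirr hfin hL (fun ℓ _ hne hm ↦ hram ℓ hne hm) hRam K hK hH
  have hp2 : p ≠ 2 := by omega
  exact ⟨Dt, β, ι, fun d₁ P hP hPinf M₀ hdiv hndiv ↦
    indexLowerBoundAt_of_kolyvaginClass_one_ne_zero_of_mccallum W K hMc hCM hK h3 h4 hH p hp2 hsurj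
      Dt β ι d₁ P hP hPinf hrank hiv hdiv hndiv d hn hne⟩

end Consumer

end Summit.BirchSwinnertonDyer.Rank1Residual.X11b.Three.Koly

end
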